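import Literature.MathematicalPhysics.QuantumFieldTheory.Balaban1983to89.B9Eq335CoveragePAtLettersY

/-!
# `Balaban1983to89.B9Eq335ClassBridgePV1` — T. Bałaban, *Propagators for lattice gauge theories in a background field*, Commun. Math. Phys. **99** (1985)
# 389–434 [Balaban1985BackgroundPropagators] p. 396 (the cube class of (3.35)–(3.36), «Here O(1) will mean a number ≧ 10»): PRINT'S CLASS (node00-def-Y's
# MODULE 2-P `B9BackgroundsKLevelV1P.cubeClassP`, per-cube constant `n·M·α₀`, sizes open-ended) IMPLIES MODULE 2's SMALL-CUBE VARIANT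
# (`B9BackgroundsKLevelV1.cubeClass396`, sizes `1 ≤ n ≤ 10`, ONE constant `c′·M·α₀`) at the threshold `c′ = 10·L³` ((3.36): `10·L⁴`)

statement-level skeleton of published theorems with citation tags; proofs where landed; nothing here is a claim about the Yang–Mills mass gap

THE PRINT (verbatim, p. 396).  *«For each cube □ of this class there exists a unique index j, 0 ≦ j ≦ k, such that □ ⊂ Bʲ(Λ_j) ∪ B^{j+1}(Λ_{j+1}), □ ∩ Bʲ(Λ_j) ≠ ∅, and
□ is a union of several big blocks of the lattice T_{L^{−j}}, which implies that its size in the lattice T_η is O(1)MLʲη. Here O(1) will mean a number ≧ 10. … there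
exists a gauge transformation u on □ such that U^u = e^{iηA}. and if the index of □ is j, then |A| < O(1)Mα₀(Lʲη)⁻¹, |∇^ηA| < O(1)Mα₀(Lʲη)⁻² on □, where O(1)M is
a size of □»*; p. 409: *«α₀ so small that O(1)Mα₀ is still sufficiently small»*.

WHY THIS FILE (cell context).  node00-def-Y g22 RULING-W (pub-ymgap INBOX 2026-08-28 11:41Z), (R-W4): the N06 certificate of record is premised on print's class
`(bg9YP 𝔸 G x).Reg335 c35Y α₀ U` (MODULE 2-P), while the width seats' local files (n06-w1 28∕31b∕32, n06-w7, this seat's V1 files, def-Y's own) conclude from the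
small-cube class `(bg9K …).Reg335 c α₀ U` ∕ `(bg9Y …).Reg335 c α₀ U` (MODULE 2).  THE SEAM IS CLOSED HERE ONCE: every cube of the small-cube class lies in a cube of
print's class (this seat's `B9Eq335CoveragePAtLettersY.exists_cubeClassP_plaquette` argument, run on a cube instead of a plaquette), so print's per-cube datum
RESTRICTS to it — at the same scale when the covering index is `j` (constant `10·Mα₀`), at the scale `L^{j−1}η = (Lʲη)∕L` when it is `j − 1` (constant `10L·Mα₀`,
converted to the scale `Lʲη` at the cost `L²` on (3.35)'s two bounds, `L³` on (3.36)'s third).  Hence `c′ = 10·L³` ((3.36): `10·L⁴`): every theorem typed over the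
small-cube class is consumable at the record premise by PRECOMPOSITION, constants fixed in print's order `L, M, α₀`.  def-Y's CLAIM∕INTENT-47, handed to this seat
(the coverage lineage) on the bus; decl list = def-Y's.

THE GEOMETRY (★ `exists_cubeClassP_supset`).  Let `(□, j) ∈ cubeClass396 i`: `□ = torusCube c₀ (n·S)`, `S = bigSide j`, `1 ≤ n ≤ 10`, `c₀` on the big-`j`-block grid,
levels in `{j, j+1}`, some `x ∈ □` of level `j`.  The aligned cube `Q := torusCube c₀ (10·S) ⊇ □` contains `x`, so by the collar axiom (2.2) (`B9Eq335CoverageWindow.levV1_window`,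
`10L ≤ 2L² ≤ R`) all its levels lie in `{j−1, j, j+1}`.  If no site of level `j−1` occurs, `(Q, j, 10)` is a P-triple.  Otherwise no site of level `j+1` occurs either
((2.2) at level `j`, `R ≥ 10`), `Q` is a union of `10L` big `(j−1)`-blocks meeting level `j−1`, and `(Q, j−1, 10L)` is a P-triple.  Either way `c ≤ 10` suffices.

WHAT IS PROVED (sorry-free; 0 `def`; nothing of [B9] asserted — class bookkeeping only).
* §1 ★ **`exists_cubeClassP_supset`** (`c ≤ 10`, `(□, j) ∈ cubeClass396 i` ⇒ `∃ q ∈ cubeClassP i c`, `□ ⊆ q.1`, `(q.2.1, q.2.2) = (j, 10)` or `(j − 1, 10L)`).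
* §2 conversions of r06's per-cube data (generic shifts): `reg335Cube_of_bounds_le` ∕ `reg336Cube_of_bounds_le` (monotone in the displayed bound VALUES
  `Cξ⁻¹, Cξ⁻², Cξ⁻³`), `reg336Cube_subset`, `scaleLen_succ'` (`L^{j+1}η = L·Lʲη`), ★ `reg335Cube_scale_up` (`(ξ, C) ↦ (L·ξ, L²·C)`, `L ≥ 1`, `C ≥ 0`, `ξ > 0`),
  ★ `reg336Cube_scale_up` (`(ξ, C) ↦ (L·ξ, L³·C)`).
* §3 ★★★ **`reg335_of_reg335P`**: `c ≤ 10 → 0 ≤ α₀ → (bg9KP 𝔸 G i).Reg335 c α₀ U → 10·L³ ≤ c′ → (bg9K 𝔸 G i).Reg335 c′ α₀ U`; ★★★ **`reg336_of_reg336P`** (`10·L⁴ ≤ c′`).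
* §4 member forms (both sequences `{Ω_j}`, `{Ω′_j}`): ★★★ **`regY335_of_regYP335`** (`(bg9YP 𝔸 G x).Reg335 c α₀ U → … → (bg9Y 𝔸 G x).Reg335 c′ α₀ U`), ★★★
  **`regY336_of_regYP336`**; the record-threshold corollaries `regY335_of_regYP335_ten` ∕ `regY336_of_regYP336_ten` (`c = 10`, `c′ = 10L³ ∕ 10L⁴` on the nose)
  and ★ `regY335_of_regYP335_c35Y` ∕ `regY336_of_regYP336_c35Y` (the premise spelled with MODULE 4's letter `c35Y`, as in the N06 certificate of record).
MODEL ∕ DECLARED READINGS.  def-Y's carriers and classes BY NAME (MODULES 2, 2-P, 3); `L = ℓ + 1`, `M = L·M_h`, `η = |c_f|⁻¹` of the member; the constants `10L³`, `10L⁴`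
are witnesses (print: «O(1)», L-dependent here because the small-cube class insists on the scale `Lʲη` at thin level-`j` features that print covers at index `j − 1`).
HONEST SCOPE.  Lattice geometry + bookkeeping; a BRIDGE between two typed readings of p. 396, no estimate of [B9]; NOT a node discharge, NOT summit progress;
count-neutral; nothing continuum ∕ OS ∕ mass gap ∕ Clay.  Cell `pub-ymgap` (HUMAN RULING D-0062), Track A node N06 [B9], seat `pub-ymgap-dag-n06-j` (bundle F5 +
the (3.35) coverage lineage; harness re-seat gen 23), 2026-08-28.  NEW file importing `B9Eq335CoveragePAtLettersY` only; nothing landed is modified.  Net new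
unproved facts: 0.
-/

namespace Literature.MathematicalPhysics.QuantumFieldTheory.Balaban1983to89.B9Eq335ClassBridgePV1

open Literature.MathematicalPhysics.QuantumFieldTheory.Balaban1983to89
open B6KLevelCensusIndexV1 B9BackgroundsKLevelV1 B6GlobalChartV1 Node00 B9BackgroundsKLevelV1P B9Eq335CoverageWindow B9Eq335CoveragePAtLettersY
open Literature.MathematicalPhysics.QuantumFieldTheory.Balaban1983to89.B6MultiLevelBoxOperator (bigSide)
open Literature.MathematicalPhysics.QuantumFieldTheory.Balaban1983to89.B9Eq335RegularityClasses (Reg335Cube Reg336Cube)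
open Literature.MathematicalPhysics.QuantumFieldTheory.Balaban1983to89.LatticeNorms (scaleLen)
open Literature.MathematicalPhysics.QuantumFieldTheory.Balaban1983to89.B9PinMembersKLevelV1 (MemberY bg9Y)

/-! ## §1 Every cube of the small-cube class lies in a cube of print's class -/

section Geometry

variable {d ℓ : ℕ} {hd : 1 ≤ d + 1} {hL : Odd (ℓ + 1) ∧ 1 < ℓ + 1} {b₀ b₁ : ℝ}
variable (i : KIdx d ℓ hd hL b₀ b₁)

/-- ★ **EVERY SMALL-CUBE CLASS CUBE LIES IN A CUBE OF PRINT'S CLASS** (threshold `c ≤ 10`): for `(□, j) ∈ cubeClass396 i` (an aligned cube of `n ≤ 10` big `j`-blocks,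
levels in `{j, j+1}`, meeting level `j`) the aligned cube `Q` of `10` big `j`-blocks with the same corner contains `□`, and EITHER `(Q, j, 10) ∈ cubeClassP i c` (no site of
level `j − 1` in `Q`) OR `(Q, j − 1, 10L) ∈ cubeClassP i c` (one occurs; then none of level `j + 1` by (2.2), and `Q` is `10L` big `(j−1)`-blocks per side) — the argument
of `exists_cubeClassP_plaquette` run on a cube. [cite: Balaban1985BackgroundPropagators, p.396 (the cube class, «≧ 10»); Balaban1984PropagatorsII, (2.2) p.224] -/
theorem exists_cubeClassP_supset {c : ℝ} (hc : c ≤ 10) {cube : Set (Site (PV d ℓ i.m i.K hd hL) 0)} {j : ℕ} (hq : (cube, j) ∈ cubeClass396 i) :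
    ∃ q ∈ cubeClassP i c, cube ⊆ q.1 ∧ ((q.2.1 = j ∧ q.2.2 = 10) ∨ (q.2.1 + 1 = j ∧ q.2.2 = 10 * (ℓ + 1))) := by
  classical
  obtain ⟨hj1, hjk, ⟨c₀, n, -, hn10, hc₀, -, hcube⟩, -, ⟨x, hx, hxj⟩⟩ := hq
  simp only at hj1 hjk hc₀ hcube hx hxj
  subst hcube
  set S := bigSide ℓ i.Mh j with hSdef
  have hℓ : 4 ≤ ℓ := i.hℓ
  have hR : 2 * (ℓ + 1) ^ 2 ≤ i.R := i.hR2
  have h10R : 10 * (ℓ + 1) ≤ i.R := le_trans (by nlinarith) hR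
  have hsub : torusCube c₀ (n * S) ⊆ torusCube c₀ (10 * S) := torusCube_mono c₀ (Nat.mul_le_mul_right _ hn10)
  have hxQ : x ∈ torusCube c₀ (10 * S) := hsub hx
  have hwin : ∀ y ∈ torusCube c₀ (10 * S), j ≤ levV1 i y + 1 ∧ levV1 i y ≤ j + 1 := by
    intro y hy
    have hx' : x ∈ torusCube c₀ (10 * bigSide ℓ i.Mh (levV1 i x)) := by rw [hxj]; exact hxQ
    have hy' : y ∈ torusCube c₀ (10 * bigSide ℓ i.Mh (levV1 i x)) := by rw [hxj]; exact hy
    have h := levV1_window i h10R hx' hy'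
    rw [hxj] at h
    exact h
  by_cases hlow : ∃ y ∈ torusCube c₀ (10 * S), levV1 i y + 1 = j
  · -- CASE B: a site of level `j − 1` occurs ⇒ no site of level `j + 1` (sepT at level `j`), index `j − 1`, size `10L`
    obtain ⟨y, hy, hylev⟩ := hlow
    have hy1 : 1 ≤ levV1 i y := levV1_pos i y
    have hnoup : ∀ z ∈ torusCube c₀ (10 * S), levV1 i z ≤ j := by
      intro z hz
      by_contra hzl
      push Not at hzl
      have hyl : i.D.lev (toBox i.hN y).1 = levV1 i y := rfl
      have hzl' : i.D.lev (toBox i.hN z).1 = levV1 i z := rfl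
      have hsep := i.D.sepT j (toBox i.hN y).1 (toBox i.hN y).2 (toBox i.hN z).1 (toBox i.hN z).2
        (by rw [hyl]; omega) (by rw [hzl']; omega)
      have hd' := torusSupNorm_lt_of_mem_torusCube i hy hz
      have hlt : i.R * S < 10 * S := by exact_mod_cast lt_trans hsep hd'
      have : 10 ≤ i.R := le_trans (by nlinarith) h10R
      nlinarith
    have hS' : S = (ℓ + 1) * bigSide ℓ i.Mh (j - 1) := by
      rw [hSdef]; unfold B6MultiLevelBoxOperator.bigSide
      rw [show j + 1 = (j - 1 + 1) + 1 by omega, pow_succ]; ring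
    have hcube : torusCube c₀ (10 * S) = torusCube c₀ ((10 * (ℓ + 1)) * bigSide ℓ i.Mh (j - 1)) := by
      rw [hS']; ring_nf
    refine ⟨(torusCube c₀ (10 * S), j - 1, 10 * (ℓ + 1)), ?_, hsub, Or.inr ⟨by simp only; omega, rfl⟩⟩
    rw [hcube]
    refine alignedCube_mem_cubeClassP i (j := j - 1) (n := 10 * (ℓ + 1)) (by omega) (by omega) (by omega) ?_ c₀ ?_ ?_ ?_
    · calc c ≤ 10 := hc
        _ ≤ ((10 * (ℓ + 1) : ℕ) : ℝ) := by exact_mod_cast (by omega : 10 ≤ 10 * (ℓ + 1))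
    · intro κ
      exact dvd_trans (Dvd.intro_left _ hS'.symm) (hc₀ κ)
    · intro z hz
      rw [← hcube] at hz
      have h1 := hwin z hz
      have h2 := hnoup z hz
      omega
    · exact ⟨y, by rw [← hcube]; exact hy, by omega⟩
  · -- CASE A: no site of level `j − 1` ⇒ levels in `{j, j+1}`, index `j`, size `10`
    push Not at hlow
    refine ⟨(torusCube c₀ (10 * S), j, 10), ?_, hsub, Or.inl ⟨rfl, rfl⟩⟩
    refine alignedCube_mem_cubeClassP i hj1 hjk (by norm_num) (by exact_mod_cast hc) c₀ hc₀ ?_ ⟨x, hxQ, hxj⟩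
    intro z hz
    have h1 := hwin z hz
    have h2 := hlow z hz
    omega

end Geometry

/-! ## §2 Conversions of the per-cube data (3.35) ∕ (3.35)–(3.36) in scale and constant -/

section Conversions

variable {𝔸 : Type*} [NormedRing 𝔸] [NormedAlgebra ℂ 𝔸] [CompleteSpace 𝔸] {S : Type*} {ι : Type*}
variable (T : ι → Equiv.Perm S) (U : ι → S → 𝔸ˣ)

/-- (3.35) on a cube is MONOTONE IN THE TWO DISPLAYED BOUNDS `Cξ⁻¹`, `Cξ⁻²` (the gauge `u` and the field `A` are kept).
[cite: Balaban1985BackgroundPropagators, (3.35) p.396 (strict pointwise bounds; bookkeeping)] -/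
theorem reg335Cube_of_bounds_le {η ξ ξ' C C' : ℝ} {cube : Set S} (h₁ : C * ξ⁻¹ ≤ C' * ξ'⁻¹) (h₂ : C * (ξ ^ 2)⁻¹ ≤ C' * (ξ' ^ 2)⁻¹)
    (h : Reg335Cube T U η cube ξ C) : Reg335Cube T U η cube ξ' C' := by
  obtain ⟨u, A, hu, hg, hA, hD⟩ := h
  exact ⟨u, A, hu, hg, fun κ z hz => lt_of_lt_of_le (hA κ z hz) h₁, fun κ ν z hz => lt_of_lt_of_le (hD κ ν z hz) h₂⟩

variable [Fintype ι] [LinearOrder ι]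

/-- (3.35)–(3.36) on a cube is MONOTONE IN THE THREE DISPLAYED BOUNDS `Cξ⁻¹`, `Cξ⁻²`, `Cξ⁻³`.
[cite: Balaban1985BackgroundPropagators, (3.35)–(3.36) p.396 (strict pointwise bounds; bookkeeping)] -/
theorem reg336Cube_of_bounds_le {η ξ ξ' C C' : ℝ} {cube : Set S} (h₁ : C * ξ⁻¹ ≤ C' * ξ'⁻¹) (h₂ : C * (ξ ^ 2)⁻¹ ≤ C' * (ξ' ^ 2)⁻¹)
    (h₃ : C * (ξ ^ 3)⁻¹ ≤ C' * (ξ' ^ 3)⁻¹) (h : Reg336Cube T U η cube ξ C) : Reg336Cube T U η cube ξ' C' := by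
  obtain ⟨u, A, hu, hg, hA, hD, h36⟩ := h
  exact ⟨u, A, hu, hg, fun κ z hz => lt_of_lt_of_le (hA κ z hz) h₁, fun κ ν z hz => lt_of_lt_of_le (hD κ ν z hz) h₂,
    fun μ z hz => lt_of_lt_of_le (h36 μ z hz) h₃⟩

/-- (3.35)–(3.36) on a cube RESTRICTS to sub-sets (all clauses are pointwise on the cube; twin of def-Y's `reg335Cube_subset`).
[cite: Balaban1985BackgroundPropagators, (3.35)–(3.36) p.396 («on □»)] -/
theorem reg336Cube_subset {η ξ C : ℝ} {cube cube' : Set S} (hsub : cube' ⊆ cube) (h : Reg336Cube T U η cube ξ C) :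
    Reg336Cube T U η cube' ξ C := by
  obtain ⟨u, A, hu, hg, hA, hD, h36⟩ := h
  exact ⟨u, A, fun z hz => hu z (hsub hz), fun κ z hz => hg κ z (hsub hz), fun κ z hz => hA κ z (hsub hz),
    fun κ ν z hz => hD κ ν z (hsub hz), fun μ z hz => h36 μ z (hsub hz)⟩

omit [Fintype ι] [LinearOrder ι] in
/-- the bound `C·ξ^{−m}` at the scale `ξ` is at most `(t^p·C)·(tξ)^{−m}` for `t ≥ 1`, `m ≤ p`, `C ≥ 0`, `ξ > 0` — the arithmetic of passing from the scale
`L^{j−1}η` to `Lʲη = L·L^{j−1}η`. [cite: Balaban1985BackgroundPropagators, (3.35) p.396 («(Lʲη)⁻¹, (Lʲη)⁻²»; bookkeeping)] -/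
theorem mul_pow_inv_le_scale {t ξ C : ℝ} (ht : 1 ≤ t) (hξ : 0 < ξ) (hC : 0 ≤ C) {m p : ℕ} (hmp : m ≤ p) :
    C * (ξ ^ m)⁻¹ ≤ (t ^ p * C) * ((t * ξ) ^ m)⁻¹ := by
  have htpos : 0 < t := lt_of_lt_of_le one_pos ht
  have htm : 0 < t ^ m := pow_pos htpos m
  have hξm : 0 < ξ ^ m := pow_pos hξ m
  rw [mul_pow, mul_inv, show t ^ p * C * ((t ^ m)⁻¹ * (ξ ^ m)⁻¹) = (t ^ p * (t ^ m)⁻¹) * (C * (ξ ^ m)⁻¹) by ring]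
  have hCξ : 0 ≤ C * (ξ ^ m)⁻¹ := mul_nonneg hC (inv_nonneg.mpr hξm.le)
  have h1 : 1 ≤ t ^ p * (t ^ m)⁻¹ := by
    rw [← div_eq_mul_inv, le_div_iff₀ htm, one_mul]
    exact pow_le_pow_right₀ ht hmp
  calc C * (ξ ^ m)⁻¹ = 1 * (C * (ξ ^ m)⁻¹) := (one_mul _).symm
    _ ≤ (t ^ p * (t ^ m)⁻¹) * (C * (ξ ^ m)⁻¹) := mul_le_mul_of_nonneg_right h1 hCξ

omit [Fintype ι] [LinearOrder ι] in
/-- ★ SCALING UP (3.35) on a cube: the datum at the scale `ξ` with the constant `C ≥ 0` gives the datum at the scale `t·ξ` with the constant `t²·C` (`t ≥ 1`;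
at `t = L`: from the index `j − 1` to the index `j`). [cite: Balaban1985BackgroundPropagators, (3.35) p.396] -/
theorem reg335Cube_scale_up {η ξ C t : ℝ} {cube : Set S} (ht : 1 ≤ t) (hξ : 0 < ξ) (hC : 0 ≤ C) (h : Reg335Cube T U η cube ξ C) :
    Reg335Cube T U η cube (t * ξ) (t ^ 2 * C) := by
  refine reg335Cube_of_bounds_le T U ?_ ?_ h
  · have := mul_pow_inv_le_scale (m := 1) (p := 2) ht hξ hC (by norm_num)
    simpa only [pow_one] using this
  · exact mul_pow_inv_le_scale (m := 2) (p := 2) ht hξ hC le_rfl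

/-- ★ SCALING UP (3.35)–(3.36) on a cube: `(ξ, C) ↦ (t·ξ, t³·C)` (`t ≥ 1`, `C ≥ 0`, `ξ > 0`). [cite: Balaban1985BackgroundPropagators, (3.35)–(3.36) p.396] -/
theorem reg336Cube_scale_up {η ξ C t : ℝ} {cube : Set S} (ht : 1 ≤ t) (hξ : 0 < ξ) (hC : 0 ≤ C) (h : Reg336Cube T U η cube ξ C) :
    Reg336Cube T U η cube (t * ξ) (t ^ 3 * C) := by
  refine reg336Cube_of_bounds_le T U ?_ ?_ ?_ h
  · have := mul_pow_inv_le_scale (m := 1) (p := 3) ht hξ hC (by norm_num)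
    simpa only [pow_one] using this
  · exact mul_pow_inv_le_scale (m := 2) (p := 3) ht hξ hC (by norm_num)
  · exact mul_pow_inv_le_scale (m := 3) (p := 3) ht hξ hC le_rfl

omit [CompleteSpace 𝔸] [Fintype ι] [LinearOrder ι] in
/-- `L^{j+1}η = L·(Lʲη)`. [cite: Balaban1985BackgroundPropagators, (3.41) p.397 (the scales Lʲη; bookkeeping)] -/
theorem scaleLen_succ' (L η : ℝ) (j : ℕ) : scaleLen L η (j + 1) = L * scaleLen L η j := by
  unfold LatticeNorms.scaleLen; rw [pow_succ]; ring

end Conversions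

/-! ## §3 Print's class implies the small-cube class, at one index -/

section Bridge

variable {d ℓ : ℕ} {hd : 1 ≤ d + 1} {hL : Odd (ℓ + 1) ∧ 1 < ℓ + 1} {b₀ b₁ : ℝ}
variable {𝔸 : Type} [NormedRing 𝔸] [NormedAlgebra ℂ 𝔸] [CompleteSpace 𝔸] {G : Subgroup 𝔸ˣ}

/-- the (3.35) per-cube datum of a small-cube class cube `(□, j)` at the scale `Lʲη` with the constant `10L³·(M·α₀)`, read off print's class at the threshold
`c ≤ 10` via the covering P-triple of §1. [cite: Balaban1985BackgroundPropagators, (3.35) p.396] -/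
theorem reg335Cube_cubeClass396_of_reg335P (i : KIdx d ℓ hd hL b₀ b₁) {c α₀ : ℝ} (hc : c ≤ 10) (hα : 0 ≤ α₀) {U : CfgV1 (PV d ℓ i.m i.K hd hL) 𝔸}
    (h : (bg9KP 𝔸 G i).Reg335 c α₀ U) {cube : Set (Site (PV d ℓ i.m i.K hd hL) 0)} {j : ℕ} (hq : (cube, j) ∈ cubeClass396 i) :
    Reg335Cube (shiftsV1 (PV d ℓ i.m i.K hd hL)) U (kGeo i).eta cube (scaleLen (kGeo i).L (kGeo i).eta j)
      (10 * (kGeo i).L ^ 3 * ((kGeo i).M * α₀)) := by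
  obtain ⟨hη, hL1, hM⟩ := eta_pos_L_one_le_M_pos i
  have hMα : 0 ≤ (kGeo i).M * α₀ := mul_nonneg hM.le hα
  have hL0 : 0 < (kGeo i).L := lt_of_lt_of_le one_pos hL1
  obtain ⟨q, hqP, hsub, hcase⟩ := exists_cubeClassP_supset i hc hq
  have hdat := reg335CubeP_of_reg335P_subset (𝔸 := 𝔸) (G := G) i h hqP hsub
  rcases hcase with ⟨hj, hn⟩ | ⟨hj, hn⟩
  · -- covering index `j`, size `10`: same scale, constant `10·Mα₀ ≤ 10L³·Mα₀`
    rw [hj, hn] at hdat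
    refine reg335Cube_mono_const (le_of_lt (LatticeNorms.scaleLen_pos hL0 hη j)) ?_ hdat
    have h1 : (1 : ℝ) ≤ (kGeo i).L ^ 3 := one_le_pow₀ hL1
    simp only [Nat.cast_ofNat]
    nlinarith [mul_nonneg (sub_nonneg.2 h1) hMα]
  · -- covering index `j − 1`, size `10L`: scale `L^{j−1}η ↦ Lʲη` at the cost `L²`
    rw [hn] at hdat
    have hjs : j = q.2.1 + 1 := hj.symm
    rw [hjs, scaleLen_succ']
    have hsc := reg335Cube_scale_up (shiftsV1 (PV d ℓ i.m i.K hd hL)) U (t := (kGeo i).L) hL1 (LatticeNorms.scaleLen_pos hL0 hη q.2.1)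
      (mul_nonneg (by positivity) hMα) hdat
    refine reg335Cube_mono_const (mul_nonneg hL0.le (le_of_lt (LatticeNorms.scaleLen_pos hL0 hη q.2.1))) (le_of_eq ?_) hsc
    push_cast
    ring

/-- the (3.35)–(3.36) per-cube datum of a small-cube class cube at the scale `Lʲη` with the constant `10L⁴·(M·α₀)`, read off print's class (`c ≤ 10`).
[cite: Balaban1985BackgroundPropagators, (3.35)–(3.36) p.396] -/
theorem reg336Cube_cubeClass396_of_reg336P (i : KIdx d ℓ hd hL b₀ b₁) {c α₀ : ℝ} (hc : c ≤ 10) (hα : 0 ≤ α₀) {U : CfgV1 (PV d ℓ i.m i.K hd hL) 𝔸}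
    (h : (bg9KP 𝔸 G i).Reg336 c α₀ U) {cube : Set (Site (PV d ℓ i.m i.K hd hL) 0)} {j : ℕ} (hq : (cube, j) ∈ cubeClass396 i) :
    Reg336Cube (shiftsV1 (PV d ℓ i.m i.K hd hL)) U (kGeo i).eta cube (scaleLen (kGeo i).L (kGeo i).eta j)
      (10 * (kGeo i).L ^ 4 * ((kGeo i).M * α₀)) := by
  obtain ⟨hη, hL1, hM⟩ := eta_pos_L_one_le_M_pos i
  have hMα : 0 ≤ (kGeo i).M * α₀ := mul_nonneg hM.le hα
  have hL0 : 0 < (kGeo i).L := lt_of_lt_of_le one_pos hL1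
  obtain ⟨q, hqP, hsub, hcase⟩ := exists_cubeClassP_supset i hc hq
  have hdat : Reg336Cube (shiftsV1 (PV d ℓ i.m i.K hd hL)) U (kGeo i).eta cube (scaleLen (kGeo i).L (kGeo i).eta q.2.1)
      ((q.2.2 : ℝ) * ((kGeo i).M * α₀)) := reg336Cube_subset _ U hsub (h.2 q hqP)
  have hξ : 0 < scaleLen (kGeo i).L (kGeo i).eta q.2.1 := LatticeNorms.scaleLen_pos hL0 hη q.2.1
  rcases hcase with ⟨hj, hn⟩ | ⟨hj, hn⟩
  · rw [hj, hn] at hdat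
    rw [hj] at hξ
    have h1 : (1 : ℝ) ≤ (kGeo i).L ^ 4 := one_le_pow₀ hL1
    have hcc : ((10 : ℕ) : ℝ) * ((kGeo i).M * α₀) ≤ 10 * (kGeo i).L ^ 4 * ((kGeo i).M * α₀) := by
      simp only [Nat.cast_ofNat]
      nlinarith [mul_nonneg (sub_nonneg.2 h1) hMα]
    refine reg336Cube_of_bounds_le _ U ?_ ?_ ?_ hdat
    all_goals exact mul_le_mul_of_nonneg_right hcc (inv_nonneg.mpr (by positivity))
  · rw [hn] at hdat
    have hjs : j = q.2.1 + 1 := hj.symm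
    rw [hjs, scaleLen_succ']
    have hsc := reg336Cube_scale_up (shiftsV1 (PV d ℓ i.m i.K hd hL)) U (t := (kGeo i).L) hL1 hξ (mul_nonneg (by positivity) hMα) hdat
    have hξ' : 0 < (kGeo i).L * scaleLen (kGeo i).L (kGeo i).eta q.2.1 := mul_pos hL0 hξ
    refine reg336Cube_of_bounds_le _ U ?_ ?_ ?_ hsc
    all_goals
      refine mul_le_mul_of_nonneg_right (le_of_eq ?_) (inv_nonneg.mpr (by positivity))
      push_cast
      ring

/-- ★★★ **PRINT'S CLASS (3.35) IMPLIES THE SMALL-CUBE CLASS (3.35) at the threshold `c′ ≥ 10·L³`**: `(bg9KP 𝔸 G i).Reg335 c α₀ U` (`c ≤ 10`, `α₀ ≥ 0`) ⇒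
`(bg9K 𝔸 G i).Reg335 c′ α₀ U` — every theorem typed over MODULE 2's class is consumable at the record premise by precomposition with `c ↦ 10L³`.
[cite: Balaban1985BackgroundPropagators, (3.35) p.396 (the class, «≧ 10»), p.409 («O(1)Mα₀ … sufficiently small»)] -/
theorem reg335_of_reg335P (i : KIdx d ℓ hd hL b₀ b₁) {c c' α₀ : ℝ} (hc : c ≤ 10) (hα : 0 ≤ α₀) {U : CfgV1 (PV d ℓ i.m i.K hd hL) 𝔸}
    (h : (bg9KP 𝔸 G i).Reg335 c α₀ U) (hc' : 10 * (kGeo i).L ^ 3 ≤ c') : (bg9K 𝔸 G i).Reg335 c' α₀ U := by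
  obtain ⟨hη, hL1, hM⟩ := eta_pos_L_one_le_M_pos i
  have hMα : 0 ≤ (kGeo i).M * α₀ := mul_nonneg hM.le hα
  have hL0 : 0 < (kGeo i).L := lt_of_lt_of_le one_pos hL1
  refine ⟨h.1, fun q hq => ?_⟩
  have hdat := reg335Cube_cubeClass396_of_reg335P (G := G) i hc hα h (cube := q.1) (j := q.2) hq
  refine reg335Cube_mono_const (le_of_lt (LatticeNorms.scaleLen_pos hL0 hη q.2)) ?_ hdat
  calc 10 * (kGeo i).L ^ 3 * ((kGeo i).M * α₀) ≤ c' * ((kGeo i).M * α₀) := mul_le_mul_of_nonneg_right hc' hMα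
    _ = c' * (kGeo i).M * α₀ := by ring

/-- ★★★ **PRINT'S CLASS (3.35)–(3.36) IMPLIES THE SMALL-CUBE CLASS (3.35)–(3.36) at the threshold `c′ ≥ 10·L⁴`**.
[cite: Balaban1985BackgroundPropagators, (3.35)–(3.36) p.396 (the class, «≧ 10»), p.409] -/
theorem reg336_of_reg336P (i : KIdx d ℓ hd hL b₀ b₁) {c c' α₀ : ℝ} (hc : c ≤ 10) (hα : 0 ≤ α₀) {U : CfgV1 (PV d ℓ i.m i.K hd hL) 𝔸}
    (h : (bg9KP 𝔸 G i).Reg336 c α₀ U) (hc' : 10 * (kGeo i).L ^ 4 ≤ c') : (bg9K 𝔸 G i).Reg336 c' α₀ U := by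
  obtain ⟨hη, hL1, hM⟩ := eta_pos_L_one_le_M_pos i
  have hMα : 0 ≤ (kGeo i).M * α₀ := mul_nonneg hM.le hα
  have hL0 : 0 < (kGeo i).L := lt_of_lt_of_le one_pos hL1
  refine ⟨h.1, fun q hq => ?_⟩
  have hdat := reg336Cube_cubeClass396_of_reg336P (G := G) i hc hα h (cube := q.1) (j := q.2) hq
  have hξ : 0 < scaleLen (kGeo i).L (kGeo i).eta q.2 := LatticeNorms.scaleLen_pos hL0 hη q.2
  have hcc : 10 * (kGeo i).L ^ 4 * ((kGeo i).M * α₀) ≤ c' * (kGeo i).M * α₀ :=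
    calc 10 * (kGeo i).L ^ 4 * ((kGeo i).M * α₀) ≤ c' * ((kGeo i).M * α₀) := mul_le_mul_of_nonneg_right hc' hMα
      _ = c' * (kGeo i).M * α₀ := by ring
  refine reg336Cube_of_bounds_le _ U ?_ ?_ ?_ hdat
  all_goals exact mul_le_mul_of_nonneg_right hcc (inv_nonneg.mpr (by positivity))

end Bridge

/-! ## §4 Member forms (both sequences), and the record threshold `c = 10` -/

section Member

variable {d ℓ : ℕ} {hd : 1 ≤ d + 1} {hL : Odd (ℓ + 1) ∧ 1 < ℓ + 1} {b₀ b₁ : ℝ} {Mstar : ℕ}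
variable {𝔸 : Type} [NormedRing 𝔸] [NormedAlgebra ℂ 𝔸] [CompleteSpace 𝔸] {G : Subgroup 𝔸ˣ}

/-- ★★★ **MEMBER FORM**: print's class (3.35) of a member (both sequences `{Ω_j}`, `{Ω′_j}`, def-Y's `bg9YP`) implies MODULE 3's small-cube class (3.35) (`bg9Y`) at
`c′ ≥ 10·L³`. [cite: Balaban1985BackgroundPropagators, (3.35) p.396, Thm 3.14 pp.426–427 (both sequences)] -/
theorem regY335_of_regYP335 (x : MemberY d ℓ hd hL b₀ b₁ Mstar) {c c' α₀ : ℝ} (hc : c ≤ 10) (hα : 0 ≤ α₀) {U : CfgV1 (PV d ℓ x.m x.K hd hL) 𝔸}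
    (h : (bg9YP 𝔸 G x).Reg335 c α₀ U) (hc' : 10 * ((ℓ + 1 : ℕ) : ℝ) ^ 3 ≤ c') : (bg9Y 𝔸 G x).Reg335 c' α₀ U :=
  ⟨reg335_of_reg335P x.toKIdx hc hα h.1 hc', reg335_of_reg335P x.snd hc hα h.2 hc'⟩

/-- ★★★ **MEMBER FORM, (3.35)–(3.36)** at `c′ ≥ 10·L⁴`. [cite: Balaban1985BackgroundPropagators, (3.35)–(3.36) p.396, Thm 3.14 pp.426–427] -/
theorem regY336_of_regYP336 (x : MemberY d ℓ hd hL b₀ b₁ Mstar) {c c' α₀ : ℝ} (hc : c ≤ 10) (hα : 0 ≤ α₀) {U : CfgV1 (PV d ℓ x.m x.K hd hL) 𝔸}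
    (h : (bg9YP 𝔸 G x).Reg336 c α₀ U) (hc' : 10 * ((ℓ + 1 : ℕ) : ℝ) ^ 4 ≤ c') : (bg9Y 𝔸 G x).Reg336 c' α₀ U :=
  ⟨reg336_of_reg336P x.toKIdx hc hα h.1 hc', reg336_of_reg336P x.snd hc hα h.2 hc'⟩

/-- AT THE RECORD THRESHOLD `c = 10` (the pin `c35Y = 10`): `(bg9YP …).Reg335 10 α₀ U ⇒ (bg9Y …).Reg335 (10·L³) α₀ U`.
[cite: Balaban1985BackgroundPropagators, (3.35) p.396 («≧ 10»)] -/
theorem regY335_of_regYP335_ten (x : MemberY d ℓ hd hL b₀ b₁ Mstar) {α₀ : ℝ} (hα : 0 ≤ α₀) {U : CfgV1 (PV d ℓ x.m x.K hd hL) 𝔸}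
    (h : (bg9YP 𝔸 G x).Reg335 10 α₀ U) : (bg9Y 𝔸 G x).Reg335 (10 * ((ℓ + 1 : ℕ) : ℝ) ^ 3) α₀ U :=
  regY335_of_regYP335 x le_rfl hα h le_rfl

/-- AT THE RECORD THRESHOLD `c = 10`, (3.35)–(3.36): `(bg9YP …).Reg336 10 α₀ U ⇒ (bg9Y …).Reg336 (10·L⁴) α₀ U`.
[cite: Balaban1985BackgroundPropagators, (3.35)–(3.36) p.396 («≧ 10»)] -/
theorem regY336_of_regYP336_ten (x : MemberY d ℓ hd hL b₀ b₁ Mstar) {α₀ : ℝ} (hα : 0 ≤ α₀) {U : CfgV1 (PV d ℓ x.m x.K hd hL) 𝔸}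
    (h : (bg9YP 𝔸 G x).Reg336 10 α₀ U) : (bg9Y 𝔸 G x).Reg336 (10 * ((ℓ + 1 : ℕ) : ℝ) ^ 4) α₀ U :=
  regY336_of_regYP336 x le_rfl hα h le_rfl

/-- ★ AT THE RECORD'S LETTER `c35Y` (MODULE 4 `B9PinGeometryKLevelV1.c35Y = 10`, the N06 certificate's premise `(bg9YP 𝔸 G x).Reg335 c35Y α₀ U`): the small-cube
class (3.35) at `10·L³`, no unfolding left to the consumer (def-Y's letter preference). [cite: Balaban1985BackgroundPropagators, (3.35) p.396 («≧ 10»)] -/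
theorem regY335_of_regYP335_c35Y (x : MemberY d ℓ hd hL b₀ b₁ Mstar) {α₀ : ℝ} (hα : 0 ≤ α₀) {U : CfgV1 (PV d ℓ x.m x.K hd hL) 𝔸}
    (h : (bg9YP 𝔸 G x).Reg335 B9PinGeometryKLevelV1.c35Y α₀ U) : (bg9Y 𝔸 G x).Reg335 (10 * ((ℓ + 1 : ℕ) : ℝ) ^ 3) α₀ U :=
  regY335_of_regYP335 x (by norm_num [B9PinGeometryKLevelV1.c35Y]) hα h le_rfl

/-- ★ AT THE RECORD'S LETTER `c35Y`, (3.35)–(3.36): the small-cube class at `10·L⁴`. [cite: Balaban1985BackgroundPropagators, (3.35)–(3.36) p.396 («≧ 10»)] -/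
theorem regY336_of_regYP336_c35Y (x : MemberY d ℓ hd hL b₀ b₁ Mstar) {α₀ : ℝ} (hα : 0 ≤ α₀) {U : CfgV1 (PV d ℓ x.m x.K hd hL) 𝔸}
    (h : (bg9YP 𝔸 G x).Reg336 B9PinGeometryKLevelV1.c35Y α₀ U) : (bg9Y 𝔸 G x).Reg336 (10 * ((ℓ + 1 : ℕ) : ℝ) ^ 4) α₀ U :=
  regY336_of_regYP336 x (by norm_num [B9PinGeometryKLevelV1.c35Y]) hα h le_rfl

end Member

end Literature.MathematicalPhysics.QuantumFieldTheory.Balaban1983to89.B9Eq335ClassBridgePV1
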